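import Literature.MathematicalPhysics.QuantumLattice.HubbardOneParticleCost
import Literature.MathematicalPhysics.QuantumLattice.HubbardParityTwistedTrace
import Summits.HubbardSuperconductivity.HubbardSuperconductivity.Theorems.KacWindowPenaltyWindowGapPenalisedForms
import HarnessLib

/-!
# Stub `stub_gcBlockFloor` of line `sector-invisible-dressing`
# (crux `WindowGap`, item stmt-HubbardSuperconductivity-1088, route KacWindowPenalty)

The GRAND-CANONICAL → CANONICAL block floor. The line dresses the Hubbard torus
`H = hubbardTorus 2 L 1 U` with a chemical shift `−μ(N̂ − N_t)` and a Kac charging `k(N̂ − N_t)²`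
and minimises over the WHOLE Fock space `⊤`. Both dressings are functions of the particle number
`N̂ = totalNumber`, which acts diagonally in the occupation basis (`totalNumber_mulVec`:
`(N̂ψ)(s) = |s| ψ(s)`), and `H` is block diagonal in `|s|`
(`HubbardBandBottom.hamiltonian_apply_eq_zero_of_card_ne`). Hence the quadratic form of
`H' = H − μ(N̂ − N_t) + k(N̂ − N_t)²` splits over the sectors `N = |s| ≤ 2L²`, and on the `N`-block it
is `≥ (E(N) − μ(N − N_t) + k(N − N_t)²) ‖φ_N‖²` with `E(N) = groundEnergyAt (fermionTorusGraph 2 L) 1 U N`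
(`ThermodynamicLimit.groundEnergyAt_mul_norm_le`); summing with `Σ_N ‖φ_N‖² = 1`:

  `minEnergyOn H' ⊤ ≥ min_{N ≤ 2L²} [E(N) − μ(N − N_t) + k(N − N_t)²]`.

The sector splitting is taken from `HubbardParityTwistedTrace.lean`
(`HubbardBandBottom.re_rayleigh_add_diagonal_nonneg`: sector floors `m(N)` make `H + diag(−m(|s|))`
a nonnegative form); here it is repackaged as the abstract floor
`le_minEnergyOn_top_of_sectorFloors` (any number-preserving `H`, any number-diagonal dressing `D`)
and specialised to the torus.

Sources: H. Tasaki, *Physics and Mathematics of Quantum Many-Body Systems* (2020), §2.1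
(variational principle in finite volume) and §9.2 (particle-number sectors of the Fock space);
O. Bratteli, D. W. Robinson, *Operator Algebras and QSM II*, §5.2.2. No new definitions.
Supports the crux (`--supports stmt-HubbardSuperconductivity-1088`).
-/

-- the mandated namespace `Summit.<Summit>.<Problem>.Theorems` repeats `HubbardSuperconductivity`
-- (single-problem summit, D-0017), which the `dupNamespace` linter flags on every declaration
set_option linter.dupNamespace false

namespace Summit.HubbardSuperconductivity.HubbardSuperconductivity.Theorems

open Matrix Literature.MathematicalPhysics.QuantumLattice
open Literature.MathematicalPhysics.QuantumLattice.HubbardBandBottom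
  (re_rayleigh_add_diagonal_nonneg hamiltonian_apply_eq_zero_of_card_ne)
open Literature.MathematicalPhysics.QuantumLattice.RayleighBound
  (normSq star_dotProduct_self_eq_normSq normSq_nonneg)

section Abstract

variable {ι : Type*} [Fintype ι]

/-- `Re Σ_i conj(φ i) · (g i · φ i) = Σ_i g i ‖φ i‖²` for real weights `g`: the quadratic form of a
real diagonal multiplier. [folklore] -/
theorem re_star_dotProduct_ofReal_mul {n : Type*} [Fintype n] (g : n → ℝ) (φ : n → ℂ) :
    (star φ ⬝ᵥ fun i => ((g i : ℝ) : ℂ) * φ i).re = ∑ i, g i * ‖φ i‖ ^ 2 := by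
  rw [dotProduct, Complex.re_sum]
  refine Finset.sum_congr rfl fun i _ => ?_
  rw [Pi.star_apply, mul_left_comm, Complex.re_ofReal_mul, Complex.star_def, Complex.conj_mul',
    ← Complex.ofReal_pow, Complex.ofReal_re]

/-- **Whole-space floor from sector floors (block decomposition in the particle number).**
Let `H` preserve the particle number (`H s t = 0` unless `|s| = |t|`), let the dressing `D` act as
the number-diagonal multiplier `(Dφ)(s) = g(|s|) φ(s)` with real `g`, and let `m(N)` be sector
floors of `H`: `m(N) ‖φ‖² ≤ Re ⟨φ, Hφ⟩` on every `N`-particle `φ`. If `e ≤ m(N) + g(N)` for every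
`N ≤ |ι|`, then `e ≤ minEnergyOn (H + D) ⊤`: for a unit `φ = Σ_N φ_N`,
`Re ⟨φ, (H + D)φ⟩ = Σ_N [Re ⟨φ_N, Hφ_N⟩ + g(N)‖φ_N‖²] ≥ Σ_N (m(N) + g(N))‖φ_N‖² ≥ e`
(`HubbardBandBottom.re_rayleigh_add_diagonal_nonneg` with the floors `e − g(N)`).
Tasaki (2020) §2.1, §9.2. [folklore] -/
theorem le_minEnergyOn_top_of_sectorFloors (H D : Matrix (Finset ι) (Finset ι) ℂ)
    (hH : ∀ s t : Finset ι, s.card ≠ t.card → H s t = 0) (g : ℕ → ℝ)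
    (hD : ∀ (φ : Fock ι) (s : Finset ι), (D *ᵥ φ) s = ((g s.card : ℝ) : ℂ) * φ s) (m : ℕ → ℝ)
    (hm : ∀ (N : ℕ) (φ : Fock ι), IsNParticle N φ → m N * normSq φ ≤ (star φ ⬝ᵥ H *ᵥ φ).re)
    (e : ℝ) (he : ∀ N : ℕ, N ≤ Fintype.card ι → e ≤ m N + g N) :
    e ≤ (H + D).minEnergyOn ⊤ := by
  classical
  -- the shifted floors `e - g N` of `H` (empty sectors above `|ι|` carry only `φ = 0`)
  have hm' : ∀ (N : ℕ) (φ : Fock ι), IsNParticle N φ →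
      (e - g N) * normSq φ ≤ (star φ ⬝ᵥ H *ᵥ φ).re := by
    intro N φ hφ
    by_cases hN : N ≤ Fintype.card ι
    · exact (mul_le_mul_of_nonneg_right (by linarith [he N hN]) (normSq_nonneg φ)).trans
        (hm N φ hφ)
    · have hφ0 : φ = 0 := funext fun s => hφ s fun h => hN (by rw [← h]; exact s.card_le_univ)
      subst hφ0
      simp [normSq]
  -- the variational set is nonempty (the vacuum is a unit vector of `⊤`)
  unfold Matrix.minEnergyOn
  refine le_csInf ⟨_, Pi.single ∅ 1, Submodule.mem_top, ?_, rfl⟩ ?_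
  · rw [dotProduct_single, Pi.star_apply, Pi.single_eq_same, star_one, one_mul]
  rintro E ⟨φ, -, hφ, rfl⟩
  -- sector splitting: `0 ≤ Re ⟨φ, (H + diag (g(|s|) - e)) φ⟩`
  have key : 0 ≤ (star φ ⬝ᵥ (H + diagonal fun s : Finset ι => ((g s.card - e : ℝ) : ℂ)) *ᵥ φ).re := by
    have h := re_rayleigh_add_diagonal_nonneg H hH (fun N => e - g N) hm' φ
    simp only [neg_sub] at h
    exact h
  have hnorm : ∑ s, ‖φ s‖ ^ 2 = 1 := by
    have h := congrArg Complex.re hφ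
    rwa [star_dotProduct_self_eq_normSq, Complex.ofReal_re, Complex.one_re] at h
  -- the diagonal term of `key` and the dressing term of the goal are the same weighted norm
  have hdiag : (star φ ⬝ᵥ (diagonal fun s : Finset ι => ((g s.card - e : ℝ) : ℂ)) *ᵥ φ).re =
      ∑ s, g s.card * ‖φ s‖ ^ 2 - e := by
    have h : (diagonal fun s : Finset ι => ((g s.card - e : ℝ) : ℂ)) *ᵥ φ =
        fun s => ((g s.card - e : ℝ) : ℂ) * φ s := funext fun s => mulVec_diagonal _ _ s
    rw [h, re_star_dotProduct_ofReal_mul]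
    simp only [sub_mul, Finset.sum_sub_distrib]
    rw [← Finset.mul_sum, hnorm, mul_one]
  have hdress : (star φ ⬝ᵥ D *ᵥ φ).re = ∑ s, g s.card * ‖φ s‖ ^ 2 := by
    have h : D *ᵥ φ = fun s => ((g s.card : ℝ) : ℂ) * φ s := funext (hD φ)
    rw [h, re_star_dotProduct_ofReal_mul]
  rw [add_mulVec, dotProduct_add, Complex.add_re] at key ⊢
  linarith [key, hdiag, hdress]

end Abstract

section Hubbard

variable {Λ : Type*} [LinearOrder Λ] [Fintype Λ] (G : SimpleGraph Λ) [DecidableRel G.Adj]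

/-- The sector variational bound with the real squared norm: `E(N) ‖φ‖² ≤ Re ⟨φ, Hφ⟩` on every
`N`-particle `φ` (`ThermodynamicLimit.groundEnergyAt_mul_norm_le`; for `N > 2|Λ|` both sides
vanish). Tasaki (2020) §2.1. [folklore] -/
theorem groundEnergyAt_mul_normSq_le (t U : ℝ) (N : ℕ) (φ : Fock (Orb Λ)) (hφ : IsNParticle N φ) :
    groundEnergyAt G t U N * normSq φ ≤ (star φ ⬝ᵥ hamiltonian G t U *ᵥ φ).re := by
  have h := ThermodynamicLimit.groundEnergyAt_mul_norm_le G t U hφ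
  rwa [star_dotProduct_self_eq_normSq, Complex.ofReal_re] at h

/-- **The chemical shift plus Kac charging acts diagonally** (on the `L × L` torus): with
`N̂ = totalNumber`, `((−μ(N̂ − N_t) + k(N̂ − N_t)²) φ)(s) = (−μ(|s| − N_t) + k(|s| − N_t)²) φ(s)`
(`totalNumber_mulVec`). Stated on the torus so that the scalar matrix `N_t • 1` carries the same
`DecidableEq` instance as the line's operators. Tasaki (2020) §9.2. [folklore] -/
theorem chargedShift_mulVec_apply (L : ℕ) [NeZero L] (μ k : ℝ) (Nt : ℕ)
    (φ : Fock (Orb (FermionTorus 2 L))) (s : Finset (Orb (FermionTorus 2 L))) :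
    ((-((μ : ℂ) • ((totalNumber : Matrix (Finset (Orb (FermionTorus 2 L)))
            (Finset (Orb (FermionTorus 2 L))) ℂ) - (Nt : ℂ) • 1)) +
          (k : ℂ) • (((totalNumber : Matrix (Finset (Orb (FermionTorus 2 L)))
            (Finset (Orb (FermionTorus 2 L))) ℂ) - (Nt : ℂ) • 1) *
            ((totalNumber : Matrix (Finset (Orb (FermionTorus 2 L)))
            (Finset (Orb (FermionTorus 2 L))) ℂ) - (Nt : ℂ) • 1))) *ᵥ φ) s =
      ((-(μ * ((s.card : ℝ) - Nt)) + k * ((s.card : ℝ) - Nt) ^ 2 : ℝ) : ℂ) * φ s := by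
  simp only [add_mulVec, neg_mulVec, smul_mulVec, sub_mulVec, one_mulVec, ← mulVec_mulVec,
    Pi.add_apply, Pi.neg_apply, Pi.smul_apply, Pi.sub_apply, LiebTwo.totalNumber_mulVec,
    smul_eq_mul]
  push_cast
  ring

/-- **Stub `stub_gcBlockFloor`: the grand-canonical → canonical block floor.** The chemically
shifted, Kac-charged torus `H − μ(N̂ − N_t) + k(N̂ − N_t)²` (`H = hubbardTorus 2 L 1 U`) commutes
with `N̂` and is block diagonal in the particle number (`totalNumber_mulVec`,
`HubbardBandBottom.hamiltonian_apply_eq_zero_of_card_ne`); on the `N`-block it is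
`≥ E(N) − μ(N − N_t) + k(N − N_t)²` (`ThermodynamicLimit.groundEnergyAt_mul_norm_le`,
`E(N) = groundEnergyAt (fermionTorusGraph 2 L) 1 U N`). Hence any common lower bound `e` of these
numbers over `N ≤ 2L² = |Orb Λ|` bounds its whole-space energy from below
(`le_minEnergyOn_top_of_sectorFloors`). Tasaki (2020) §2.1, §9.2. [folklore] -/
theorem stub_gcBlockFloor (L : ℕ) [NeZero L] (U μ k : ℝ) (Nt : ℕ) (e : ℝ)
    (he : ∀ N : ℕ, N ≤ 2 * L ^ 2 →
      e ≤ groundEnergyAt (fermionTorusGraph 2 L) 1 U N - μ * ((N : ℝ) - Nt) + k * ((N : ℝ) - Nt) ^ 2) :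
    e ≤ (hubbardTorus 2 L 1 U +
        (-((μ : ℂ) • ((totalNumber : Matrix (Finset (Orb (FermionTorus 2 L)))
            (Finset (Orb (FermionTorus 2 L))) ℂ) - (Nt : ℂ) • 1)) +
          (k : ℂ) • (((totalNumber : Matrix (Finset (Orb (FermionTorus 2 L)))
            (Finset (Orb (FermionTorus 2 L))) ℂ) - (Nt : ℂ) • 1) *
            ((totalNumber : Matrix (Finset (Orb (FermionTorus 2 L)))
            (Finset (Orb (FermionTorus 2 L))) ℂ) - (Nt : ℂ) • 1)))).minEnergyOn ⊤ := by
  -- `|Orb Λ| = 2L²` orbitals on the `L × L` torus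
  have hcard : Fintype.card (Orb (FermionTorus 2 L)) = 2 * L ^ 2 := by
    rw [card_orb]
    simp [FermionTorus, Fintype.card_lex]
  refine le_minEnergyOn_top_of_sectorFloors (hubbardTorus 2 L 1 U) _
    (hamiltonian_apply_eq_zero_of_card_ne (fermionTorusGraph 2 L) 1 U)
    (fun N => -(μ * ((N : ℝ) - Nt)) + k * ((N : ℝ) - Nt) ^ 2) (chargedShift_mulVec_apply L μ k Nt)
    (groundEnergyAt (fermionTorusGraph 2 L) 1 U)
    (groundEnergyAt_mul_normSq_le (fermionTorusGraph 2 L) 1 U) e fun N hN => ?_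
  have h := he N (by rw [← hcard]; exact hN)
  linarith

end Hubbard

end Summit.HubbardSuperconductivity.HubbardSuperconductivity.Theorems
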